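import Literature.AnabelianGeometry.EtaleTheta.SettingModelTateYTheta
import Literature.AnabelianGeometry.EtaleTheta.KummerDataYCoord
import Literature.AnabelianGeometry.EtaleTheta.SettingModelChiKummerDataNondeg
import Literature.AnabelianGeometry.EtaleTheta.SettingModelTateDoubleUnderline
import HarnessLib

/-!
# The STAGE-2 (Tate-sheared) χ-model of [EtTh] §1 (R78 F6q): the KUMMER DATA `KummerData.modelχq`

Mochizuki, *The étale theta function …*, Publ. RIMS **45** (2009) [EtTh], §1, Prop. 1.3 / 1.5, PRIMS PDF pp. 21–23
[cite: MochizukiEtTh2009, Prop 1.5 p.23]: the Kummer map `K^× → H¹(G_K, Δ_Θ)`, `log(U) ∈ H¹(Π^tp_Y, Δ_Θ)`, `log(Ü)`,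
`log(U)|_Ÿ = 2·log(Ü)`.

Layer L2 of the abc-iut cell, R78 cluster stage 2 («Tate shear»), row **F6q** (integrator abc-iut-L6-d6, R78-MAP #9:
«F6q/F7q → w5-d171/L2-t6»), seat abc-iut-w5-d171 (gen 3): Kummer data at abc-iut-L2-t5's stage-2 record
`ThetaSetting.modelχq p i j hj` (`SettingModelTateTheta`, F5q; `Π^tp_X := Γ ⋊_{(κ_p^i, κ_p^j, χ)} G_{ℚ_p}`, `j` even),
assembled exactly as `SettingModelChiKummerData` (F6 (c)) from:

* `KummerCore` fields: `augTheta := CurveTheta.augTheta (curveχq p i j)`; `coeffHom := deltaThetaCoordχq ∘ cycEquiv`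
  (abc-iut-L6-d6's `SettingModelTateDeltaTheta` + abc-iut-L2-t5's identification of record `cycEquiv`, continuous by
  `continuous_cycEquiv`, χ-equivariant by `deltaThetaCoordχq_chi` + `cycEquiv_smul`); Galois images and `K̈ = K`
  from the generic `map_map_gtpY(_dd)_of_comp_eq`, `finiteDimensional_Kdd_of_sqrtqX_mem`;
* the coordinate classes from the generic `ThetaSetting.YCoordKit` (`KummerDataYCoord`) fed with the stage-2
  `y`-coordinate `yThetaχq` (`SettingModelTateYTheta`): ITS CROSSED-HOMOMORPHISM LAW HOLDS ON `(Π^tp_Y)^Θ` — the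
  Tate shear is invisible on `Ker ê ⊇ pr₁(Π^tp_Y)` (`SettingModelTateYCoord`) — and it is even on `(Π^tp_Ÿ)^Θ`.

Also: `kummerDataχq_logU_ne_one` (non-degenerate `log(U)`), `exists_isEtThOrigin_and_kummerData_stage2`.
HONEST FRAMING: SEMI-SYNTHETIC model; consistency/non-vacuity evidence for the typed interface ONLY; `KHat := K^×`
honest sub-object of print's `(K^×)^∧`; nothing of [EtTh] asserted; no side taken on [IUTchIII] Cor. 3.12.
Class (b) construction over the frozen interface (no interface clause touched).
-/

noncomputable section

namespace Literature.AnabelianGeometry.EtaleTheta.SettingModel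

open Literature.AnabelianGeometry.SemiGraphs

variable (p : ℕ) [Fact p.Prime] (i j : ℤ) (hj : Even j)

/-! ### Instance key at the stage-2 quotient carrier (abbrev pitfall, cf. `SettingModelChiKummerData`) -/

/-- `Δ_Θ(curveχq)` is commutative, keyed at the quotient carrier. [cite: MochizukiEtTh2009, §1 p.12] -/
instance deltaThetaχq_isMulCommutative : IsMulCommutative (CurveTheta.thetaToEll (curveχq p i j)).ker :=
  ⟨⟨fun a b => Subtype.ext (CurveTheta.ker_thetaToEll_comm (curveχq p i j) a a.2 b b.2)⟩⟩

-- (the record-keyed instances `deltaTheta_modelχq_normal` / `deltaTheta_modelχq_isMulCommutative` are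
-- abc-iut's `SettingModelTateDoubleUnderline`, imported)

/-! ### The `y`-coordinate kit of the stage-2 model -/

/-- Elements of `Π^tp_Y = Ker(Π^tp_X ↠ ℤ)` have `Γ`-component in `Ker ê`. [cite: MochizukiEtTh2009, §1 p.13] -/
theorem eHat_gfpFst_left_eq_one_of_mem_gtpY {h : PiTpχq p i j} (hh : h ∈ (ThetaSetting.modelχq p i j hj).GtpY) :
    eHat (gfpFst h.left) = 1 :=
  eHat_gfpFst_left_eq_one p i j hh

/-- Elements of `Π^tp_Ÿ` have even `y`-coordinate at level `2`. [cite: MochizukiEtTh2009, §1 p.17] -/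
theorem hHat_two_y_eq_zero_of_mem_gtpYdd {g : PiTpχq p i j} (hg : g ∈ (ThetaSetting.modelχq p i j hj).GtpYdd) :
    (hHat 2 (gfpFst g.left)).y = 0 := by
  have h2 : g ∈ YNχq p i j (2 * 1) := (Subgroup.mem_inf.mp hg).1
  rw [mul_one] at h2
  exact ((Subgroup.mem_inf.mp ((GfpTwistData₀.mem_YN _).mp h2).1).2).2

/-- **The `y`-coordinate kit of `modelχq`.** [cite: MochizukiEtTh2009, Prop 1.5 p.23] -/
def yCoordKitχq : (ThetaSetting.modelχq p i j hj).YCoordKit where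
  chiT := (chi p).comp (CurveTheta.augTheta (curveχq p i j))
  iota := deltaThetaCoordχq p i j
  continuous_iota := continuous_deltaThetaCoordχq p i j
  iota_chiT := iota_chiT_curveχq p i j
  y := yThetaχq p i j
  continuous_y := continuous_yThetaχq p i j
  y_mul := by
    rintro g - h ⟨h₀, hh₀, rfl⟩
    exact yThetaχq_mul p i j g h₀ (eHat_gfpFst_left_eq_one_of_mem_gtpY p i j hj hh₀)
  y_even := by
    rintro g ⟨g₀, hg₀, rfl⟩
    rw [yThetaχq_toTheta]
    exact yCoordχq_mem_range_sqHom p i j (hHat_two_y_eq_zero_of_mem_gtpYdd p i j hj hg₀)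

/-! ### The Kummer core and Kummer data of the stage-2 model -/

/-- **The Kummer core of the stage-2 χ-model.** [cite: MochizukiEtTh2009, Prop 1.5 p.23] -/
def kummerCoreχq : (ThetaSetting.modelχq p i j hj).KummerCore where
  augTheta := CurveTheta.augTheta (curveχq p i j)
  continuous_augTheta := CurveTheta.continuous_augTheta (curveχq p i j)
  augTheta_toTheta _ := rfl
  coeffHom := (deltaThetaCoordχq p i j).comp (cycEquiv p).toMonoidHom
  continuous_coeffHom := (continuous_deltaThetaCoordχq p i j).comp (continuous_cycEquiv p)
  coeffHom_smul g ζ := by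
    show deltaThetaCoordχq p i j (cycEquiv p (CurveTheta.augTheta (curveχq p i j) g • ζ)) =
      MulAut.conjNormal g (deltaThetaCoordχq p i j (cycEquiv p ζ))
    rw [cycEquiv_smul, deltaThetaCoordχq_chi]
  bijective_coeffHom := (bijective_deltaThetaCoordχq p i j).comp (cycEquiv p).bijective
  map_augTheta_gtpY :=
    (ThetaSetting.modelχq p i j hj).map_map_gtpY_of_comp_eq _ (CurveTheta.augTheta_comp_toTheta (curveχq p i j))
  map_augTheta_gtpYdd :=
    (ThetaSetting.modelχq p i j hj).map_map_gtpYdd_of_comp_eq _ (CurveTheta.augTheta_comp_toTheta (curveχq p i j))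
  finiteDimensional_Kdd :=
    (ThetaSetting.modelχq p i j hj).finiteDimensional_Kdd_of_sqrtqX_mem (natCast_mem ⊥ p)
  logU := (yCoordKitχq p i j hj).logU
  logUdd := (yCoordKitχq p i j hj).logUdd
  res_logU := (yCoordKitχq p i j hj).res_logU

/-- **The Kummer data of the stage-2 χ-model.** [cite: MochizukiEtTh2009, Prop 1.5 p.23] -/
def kummerDataχq : (ThetaSetting.modelχq p i j hj).KummerData := (kummerCoreχq p i j hj).toKummerData

/-- `KummerData(modelχq)` is inhabited. [cite: MochizukiEtTh2009, Prop 1.5 p.23] -/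
theorem nonempty_kummerData_modelχq : Nonempty (ThetaSetting.modelχq p i j hj).KummerData :=
  ⟨kummerDataχq p i j hj⟩

/-- Its Kummer map is the tree's continuous Kummer map. [cite: MochizukiEtTh2009, Prop 1.5 p.23] -/
theorem kummerDataχq_kumY (x : (kummerCoreχq p i j hj).invY) :
    (kummerDataχq p i j hj).kumY x =
      (letI := (ThetaSetting.modelχq p i j hj).unitsAction (kummerCoreχq p i j hj).augTheta
       (kummerCoreχq p i j hj).coeff.kummerContMap _ (kummerCoreχq p i j hj).isOpen_stabilizer' x) :=
  rfl

/-- The image of `Δ^tp_X` centralises `Δ_Θ(modelχq)`. [cite: MochizukiEtTh2009, §1 p.12] -/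
theorem conjNormal_toThetaq_eq_self {x : PiTpχq p i j} (hx : x.right = 1)
    (a : (ThetaSetting.modelχq p i j hj).DeltaTheta) :
    MulAut.conjNormal (CurveTheta.toTheta (curveχq p i j) x) a = a := by
  apply Subtype.ext
  rw [MulAut.conjNormal_apply]
  have hy : CurveTheta.toTheta (curveχq p i j) x ∈
      ((ThetaSetting.modelχq p i j hj).aug.toMonoidHom.ker).map (ThetaSetting.modelχq p i j hj).toTheta :=
    ⟨x, hx, rfl⟩
  rw [← (ThetaSetting.modelχq p i j hj).ker_thetaToEll_central a a.2 _ hy, mul_inv_cancel_right]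

/-- **`log(U) ≠ 0` at the stage-2 model** (the cocycle takes the value `c` at `b ∈ Δ^tp_Y`). [cite: MochizukiEtTh2009, Prop 1.5 p.23] -/
theorem kummerDataχq_logU_ne_one : (kummerDataχq p i j hj).logU ≠ 1 := by
  have hmem : (SemidirectProduct.inl (bPowGfp (iotaZ (Multiplicative.ofAdd 1))) : PiTpχq p i j) ∈
      (ThetaSetting.modelχq p i j hj).GtpY := by
    show (tateTwistData₀ p i j).toZ _ = 1
    rw [GfpTwistData₀.toZ_apply, SemidirectProduct.left_inl, gfpSnd_bPowGfp]
  refine (yCoordKitχq p i j hj).logU_ne_one (bijective_deltaThetaCoordχq p i j).1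
    ⟨_, hmem, rfl⟩ (conjNormal_toThetaq_eq_self p i j hj (SemidirectProduct.right_inl _)) ?_
  show yThetaχq p i j (CurveTheta.toTheta (curveχq p i j) _) ≠ 1
  rw [yThetaχq_toTheta, yCoordχq_inl_bPowGfp]
  exact iotaZ_ofAdd_ne_one one_ne_zero

include i j hj in
/-- Kummer data with non-trivial `log(U)` at a stage-2 setting satisfying `IsEtThOrigin`.
[cite: MochizukiEtTh2009, Prop 1.5 p.23] -/
theorem exists_isEtThOrigin_and_kummerData_stage2 :
    ∃ D : ThetaSetting p, D.IsEtThOrigin ∧ ∃ k : D.KummerData, k.logU ≠ 1 :=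
  ⟨ThetaSetting.modelχq p i j hj, ThetaSetting.modelχq_isEtThOrigin p i j hj, kummerDataχq p i j hj,
    kummerDataχq_logU_ne_one p i j hj⟩

end Literature.AnabelianGeometry.EtaleTheta.SettingModel

end
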